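import Literature.ModelTheory.ExponentialFields.NewtonSentences
import Literature.ModelTheory.ExponentialFields.ExpPolyDictionary
import Literature.ModelTheory.ExponentialFields.AuxiliarySystem
import HarnessLib

/-!
# Exponential polynomial codes and row terms in an arbitrary lawful structure

Family `periods` (periods.S27), topic `Literature/ModelTheory/ExponentialFields`: glue for the
assembly of the conditional half of Macintyre–Wilkie's theorem
(`Literature.ModelTheory.ExponentialFields.macintyreWilkie_existential_of_schanuelProperty`).

The Newton scheme hands us, in a MODEL `K` of the recursive subtheory, a zero `γ̄` of the row
terms `ExpPolyCode.rowTerm n F i` (`LastRootConjecture.lean`), whose realization lemmas in the tree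
are stated in `ℝ` only.  This file evaluates them in any field `M` carrying a lawful
`Language.orderedExpRing`-structure (`RealExpModel.LawfulStructure`, with the `exp` symbol read as
`NewtonExp.expM M`), and identifies the rows of the code `ExpPolyCode.ofMvPoly N P` of an integer
polynomial with the value `P(γ̄, exp γ̄)` (`ExpPoly.expAEval`):

* `ExpPolyCode.monomialEvalWith E`, `ExpPolyCode.evalWith E` — `monomialEval`/`eval` with an
  arbitrary `E` in place of `Real.exp` (`evalWith_real`);
* `realize_intTerm_lawful`, `realize_powTerm_lawful`, `realize_prodTerm_lawful`,
  `realize_factorTerm_lawful`, `realize_monoTermX_lawful`, `realize_evalTermX_lawful`,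
  **`realize_rowTerm_lawful`**;
* `evalWith_ofMvPoly : evalWith E N (ofMvPoly N P) x = aeval (x̄, E x̄) P` (= `ExpPoly.expAEval E P x`),
  hence **`realize_rowTerm_ofMvPoly`**.

Everything here is proved.
-/

noncomputable section

open scoped BigOperators
open FirstOrder FirstOrder.Language FirstOrder.Language.Term

namespace Literature.ModelTheory.ExponentialFields

namespace ExpPolyCode

variable {M : Type*} [Field M] [LinearOrder M] [Language.orderedExpRing.Structure M]
  [RealExpModel.LawfulStructure M]

/-! ### Evaluation with an arbitrary exponential -/

/-- The value of a monomial code `(c, exponents)` at `x̄ ∈ Mⁿ`, with `E` for the exponential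
(`ExpPolyCode.monomialEval` is the case `M = ℝ`, `E = Real.exp`). [folklore] -/
def monomialEvalWith {M : Type*} [CommRing M] (E : M → M) (n : ℕ) (m : ℤ × List ℕ) (x : Fin n → M) : M :=
  (m.1 : M) * ∏ i : Fin n, (x i ^ m.2.getD (i : ℕ) 0 * E (x i) ^ m.2.getD (n + (i : ℕ)) 0)

/-- The value of an exponential polynomial code at `x̄ ∈ Mⁿ`, with `E` for the exponential
(`ExpPolyCode.eval` is the case `M = ℝ`, `E = Real.exp`). [folklore] -/
def evalWith {M : Type*} [CommRing M] (E : M → M) (n : ℕ) (p : ExpPolyCode) (x : Fin n → M) : M :=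
  (p.map fun m => monomialEvalWith E n m x).sum

/-- `evalWith` of a cons. [folklore] -/
@[simp] theorem evalWith_cons {M : Type*} [CommRing M] (E : M → M) (n : ℕ) (m : ℤ × List ℕ)
    (p : ExpPolyCode) (x : Fin n → M) :
    evalWith E n (m :: p) x = monomialEvalWith E n m x + evalWith E n p x := by
  simp [evalWith]

/-- `evalWith` of the empty code. [folklore] -/
@[simp] theorem evalWith_nil {M : Type*} [CommRing M] (E : M → M) (n : ℕ) (x : Fin n → M) :
    evalWith E n [] x = 0 := by
  simp [evalWith]

/-- In `ℝ` with `Real.exp`, `evalWith` is `eval`. [folklore] -/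
theorem evalWith_real (n : ℕ) : ∀ (p : ExpPolyCode) (x : Fin n → ℝ), evalWith Real.exp n p x = eval n p x
  | [], x => by simp [eval]
  | m :: p, x => by
    rw [evalWith_cons, evalWith_real n p x]
    simp [eval, monomialEvalWith, monomialEval]

/-! ### Realization of the term builders in a lawful structure -/

/-- Integer numerals. [folklore] -/
@[simp] theorem realize_intTerm_lawful {α : Type*} (v : α → M) :
    ∀ c : ℤ, (intTerm c : Language.orderedExpRing.Term α).realize v = c
  | Int.ofNat k => by simp [intTerm]
  | Int.negSucc k => by
    rw [intTerm, ExpTerm.realize_neg, NewtonExp.realize_natTerm_lawful, Int.negSucc_eq]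
    push_cast
    ring

/-- Powers. [folklore] -/
@[simp] theorem realize_powTerm_lawful {α : Type*} (v : α → M) (t : Language.orderedExpRing.Term α) :
    ∀ k : ℕ, (powTerm t k).realize v = t.realize v ^ k
  | 0 => by simp [powTerm]
  | k + 1 => by simp [powTerm, realize_powTerm_lawful v t k, pow_succ]

/-- Products. [folklore] -/
@[simp] theorem realize_prodTerm_lawful {α : Type*} (v : α → M) :
    ∀ l : List (Language.orderedExpRing.Term α), (prodTerm l).realize v = (l.map fun t => t.realize v).prod
  | [] => by simp [prodTerm]
  | t :: l => by simp [prodTerm, realize_prodTerm_lawful v l]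

/-- Monomial factors `t^a (exp t)^b`. [folklore] -/
@[simp] theorem realize_factorTerm_lawful {α : Type*} (v : α → M) (a b : ℕ) (t : Language.orderedExpRing.Term α) :
    (factorTerm a b t).realize v = t.realize v ^ a * NewtonExp.expM M (t.realize v) ^ b := by
  rw [factorTerm, ExpTerm.realize_mul, realize_powTerm_lawful, realize_powTerm_lawful,
    ExpTerm.realize_termExp_eq_funMap, NewtonExp.funMap_exp_eq_expM]
  rfl

/-- Monomials at a tuple of terms. [folklore] -/
@[simp] theorem realize_monoTermX_lawful {α : Type*} (n : ℕ) (v : α → M)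
    (xs : Fin n → Language.orderedExpRing.Term α) (m : ℤ × List ℕ) :
    (monoTermX n xs m).realize v = monomialEvalWith (NewtonExp.expM M) n m (fun i => (xs i).realize v) := by
  rw [monomialEvalWith, Fin.prod_univ_def]
  simp only [monoTermX, ExpTerm.realize_mul, realize_intTerm_lawful, realize_prodTerm_lawful,
    List.map_map]
  congr 2
  exact List.map_congr_left fun i _ => by simp

/-- Codes at a tuple of terms. [folklore] -/
@[simp] theorem realize_evalTermX_lawful {α : Type*} (n : ℕ) (v : α → M)
    (xs : Fin n → Language.orderedExpRing.Term α) :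
    ∀ p : ExpPolyCode, (evalTermX n xs p).realize v = evalWith (NewtonExp.expM M) n p (fun i => (xs i).realize v)
  | [] => by simp [evalTermX]
  | m :: p => by simp [evalTermX, realize_evalTermX_lawful n v xs p]

/-- **Row terms in a lawful structure**: `rowTerm n F i` realizes at `(v, x̄)` to the value of the
`i`-th code at `x̄` with the structure's exponential. [folklore] -/
@[simp] theorem realize_rowTerm_lawful (n : ℕ) (F : List ExpPolyCode) (v : Empty → M) (x : Fin n → M)
    (i : Fin n) :
    (rowTerm n F i).realize (Sum.elim v x) = evalWith (NewtonExp.expM M) n (F.getD (i : ℕ) []) x := by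
  simp [rowTerm]

/-! ### Codes of integer polynomials -/

/-- The value of the monomial `(c, expList m)` at `x̄`, generic version of
`monomialEval_expList`. [folklore] -/
theorem monomialEvalWith_expList {K : Type*} [CommRing K] (E : K → K) (N : ℕ) (c : ℤ)
    (m : (Fin N ⊕ Fin N) →₀ ℕ) (x : Fin N → K) :
    monomialEvalWith E N (c, expList N m) x =
      (c : K) * m.prod (fun v e => (Sum.elim x (E ∘ x) v) ^ e) := by
  rw [monomialEvalWith, Finsupp.prod_fintype _ _ (fun v => by simp), Fintype.prod_sum_type]
  simp only [getD_expList_inl, getD_expList_inr, Sum.elim_inl, Sum.elim_inr, Function.comp_apply,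
    Finset.prod_mul_distrib]

/-- `evalWith` of a mapped list of codes. [folklore] -/
theorem evalWith_map {K : Type*} [CommRing K] (E : K → K) (N : ℕ) {ι : Type*} (l : List ι)
    (f : ι → ℤ × List ℕ) (x : Fin N → K) :
    evalWith E N (l.map f) x = (l.map fun i => monomialEvalWith E N (f i) x).sum := by
  induction l with
  | nil => rfl
  | cons a l ih => simp [ih]

/-- **The code of `P` evaluates to `P(x̄, E x̄)`** in any commutative ring (generic version of
`eval_ofMvPoly`). [folklore] -/
theorem evalWith_ofMvPoly {K : Type*} [CommRing K] (E : K → K) (N : ℕ)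
    (P : MvPolynomial (Fin N ⊕ Fin N) ℤ) (x : Fin N → K) :
    evalWith E N (ofMvPoly N P) x = MvPolynomial.aeval (Sum.elim x (E ∘ x)) P := by
  rw [ofMvPoly, evalWith_map, Finset.sum_map_toList]
  conv_rhs => rw [P.as_sum, map_sum]
  refine Finset.sum_congr rfl fun m _ => ?_
  rw [monomialEvalWith_expList, MvPolynomial.aeval_monomial, Algebra.algebraMap_eq_smul_one, zsmul_eq_mul,
    mul_one]

/-- **Rows of a system of polynomial codes in a lawful structure**: for a family
`Q : Fin n → ℤ[x̄, ȳ]`, the `i`-th row term of the codes `ofMvPoly` realizes at `x̄` to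
`Qᵢ(x̄, exp x̄)` (`ExpPoly.expAEval`). [folklore] -/
theorem realize_rowTerm_ofMvPoly {N : ℕ} (Q : Fin N → MvPolynomial (Fin N ⊕ Fin N) ℤ)
    (v : Empty → M) (x : Fin N → M) (i : Fin N) :
    (rowTerm N (List.ofFn fun i => ofMvPoly N (Q i)) i).realize (Sum.elim v x) =
      ExpPoly.expAEval (NewtonExp.expM M) (Q i) x := by
  rw [realize_rowTerm_lawful, List.getD_eq_getElem?_getD, List.getElem?_ofFn]
  simp only [i.is_lt, ↓reduceDIte, Option.getD_some, Fin.eta, evalWith_ofMvPoly]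
  rfl

end ExpPolyCode

end Literature.ModelTheory.ExponentialFields

end
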